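import Summits.HodgeConjecture.CorCM.SimpleCMProductsDimLeThreeFibers
import Summits.HodgeConjecture.CorCM.SimpleCMDistinctClosuresPairwise
import Summits.HodgeConjecture.CorCM.PairFlipSameClosurePairwise
import Summits.HodgeConjecture.CorCM.PairFlipIsomorphicFieldsFamilies
import Summits.HodgeConjecture.CorCM.TwoSimpleCMSurfacesHodge
import Summits.HodgeConjecture.CorCM.DistinctImaginaryQuadraticSexticCMHodge
import Summits.HodgeConjecture.CorCM.SexticCMFieldPairFlip
import Literature.NumberTheory.NumberFields.AtMostTwoImaginaryQuadraticSubfields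
import Literature.NumberTheory.ComplexMultiplication.ImprimitivityBound
import HarnessLib

/-!
# Blocks of one Galois closure: simple CM abelian surfaces (at most two) and simple CM abelian threefolds (pair-flip
# fields at most three times each, non-pair-flip fields with pairwise different imaginary quadratic subfields)

COR-CM (cell `pub-hodgecm2`, binder seat `b16` gen 43, count-neutral claim CM-DIMLE3-PRODUCTS, file D4b; theorems only, no
definition, no named fact, no `sorry`).  NEW as stated, hence under `Summits/`.  The BLOCK theorems of the census of products of
simple CM abelian varieties of dimension `≤ 3` (`CorCM/SimpleCMProductsDimLeThreeHodge`): a block is a sub-family whose CM fields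
have ONE Galois closure `L ≤ ℂ`.

* `not_forall_pairFlip_of_quadratic` — a sextic CM field containing an imaginary quadratic field has no pair flip;
  `finrank_normalClosure_not_eight_dvd_of_quadratic` — hence its Galois closure has degree `6` or `12` (Dodson's bound
  `[L:ℚ] ∣ 48` and seat p2's «degree `24`/`48` ⟹ pair flips»), in particular `8 ∤ [L:ℚ]`;
* `card_le_two_of_quadratic_of_normalClosure_eq` — sextic CM fields `K_j ⊇ F_j` (imaginary quadratic) with ONE closure and
  no `F_j` embedding in another `K_{j'}`: at most two of them (`AtMostTwoImaginaryQuadraticSubfields`);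
* **`isNondegenerateFamily_sextic_block`** — simple, pairwise non-isogenous CM threefolds whose sextic CM fields have one
  Galois closure, pairwise share no imaginary quadratic field, and fall at most three into each isomorphism class of fields:
  the family is nondegenerate (fibres along «pair flips?» — cross pairs by `pairwise_pairFlip_quadraticSextic` —, then
  along the isomorphism class — cross pairs by the twin theorem `pairwise_pairFlip_of_normalClosure_le_of_isEmpty`, fibres by
  seat p2's three-classes theorem transported (`isNondegenerateFamily_of_ringEquiv_of_pairFlip_of_card_le_three`) —, and the
  non-pair-flip part has at most two members, a twin pair settled by `isNondegenerateFamily_sexticThreefolds_of_isEmpty_quadratic_ringHom`);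
* **`isNondegenerateFamily_quartic_block`** — at most two simple non-isogenous CM surfaces: nondegenerate (seat b23).

HC_CM is NOT touched.

## References

* [MoonenZarhin1999LowDim] B. Moonen, Yu. Zarhin, Math. Ann. 315 (1999), Thm. (0.2), §3 (3.1), (3.9).
* [Dodson1984] B. Dodson, *The structure of Galois groups of CM-fields*, Trans. AMS 283 (1984), §1.1, §5.1.2.
* [Gordon1999HodgeAVSurvey] B. B. Gordon, *A survey of the Hodge conjecture for abelian varieties*, §3, 7.4–7.7, 9.4.
* [Shimura1998] G. Shimura, *Abelian Varieties with Complex Multiplication and Modular Functions*, §8.4.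
-/

noncomputable section

open CategoryTheory CategoryTheory.Limits NumberField Module IntermediateField

namespace Summit.HodgeConjecture.CorCM

open Literature.NumberTheory.ComplexMultiplication
open Literature.NumberTheory.NumberFields (quadratic_eq_or_eq_or_eq_of_not_eight_dvd)
open Literature.AlgebraicGeometry.Motives (AbelianVariety CMType)
open Literature.AlgebraicGeometry.HodgeTheory
open Literature.AlgebraicGeometry.ComplexMultiplication (IsCMTypeRealisation isSimple_iff_isPrimitive)
open Literature.AlgebraicGeometry.Pohlmann1968

variable {I : Type} {K : I → Type} [∀ i, Field (K i)] [∀ i, NumberField (K i)] [∀ i, IsCMField (K i)]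

/-! ## §1 Sextic CM fields with an imaginary quadratic subfield: no pair flips, closure of degree `6` or `12` -/

section Quadratic

variable {k : Type} [Field k] [NumberField k] [IsTotallyComplex k]

omit [∀ i, NumberField (K i)] [∀ i, IsCMField (K i)] in
open scoped Classical in
/-- **A sextic CM field receiving an imaginary quadratic field `k` has no pair flip**: a flip at `s` fixes a third
embedding `t`, hence fixes `k̃` pointwise, but moves `s|_k` to its conjugate. [cite: Dodson1984, §5.1.2 Theorem] -/
theorem not_forall_pairFlip_of_quadratic {i : I} [NumberField (K i)] (h6 : finrank ℚ (K i) = 6) (hk : finrank ℚ k = 2)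
    (e : k →+* K i) :
    ¬ ∀ s : K i →+* ℂ, ∃ σ : ℂ ≃+* ℂ, σ • s = (starRingAut : ℂ ≃+* ℂ) • s ∧
      ∀ t : K i →+* ℂ, t ≠ s → t ≠ (starRingAut : ℂ ≃+* ℂ) • s → σ • t = t := by
  intro hflip
  obtain ⟨s⟩ : Nonempty (K i →+* ℂ) := inferInstance
  obtain ⟨ι₀⟩ : Nonempty (k →+* ℂ) := inferInstance
  obtain ⟨σ, hσs, hσt⟩ := hflip s
  -- a third embedding `t ∉ {s, s̄}`
  obtain ⟨t, hts, hts'⟩ : ∃ t : K i →+* ℂ, t ≠ s ∧ t ≠ (starRingAut : ℂ ≃+* ℂ) • s := by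
    by_contra hno
    push Not at hno
    have hsub : (Finset.univ : Finset (K i →+* ℂ)) ⊆ {s, (starRingAut : ℂ ≃+* ℂ) • s} := fun t _ => by
      by_cases h : t = s
      · simp [h]
      · simp [hno t h]
    have := Finset.card_le_card hsub
    rw [Finset.card_univ, Embeddings.card, h6] at this
    exact absurd (this.trans Finset.card_le_two) (by norm_num)
  have hρ : (starRingAut : ℂ ≃+* ℂ) • ι₀ ≠ ι₀ := fun h => by
    rw [conj_smul_eq_conjugate] at h
    exact IsTotallyComplex.complexEmbedding_not_isReal ι₀ (ComplexEmbedding.isReal_iff.2 h)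
  -- signs: `χ(σ) = 1` from `σ t = t`, but `sign(σ s) = sign(s̄) = −sign(s)`
  have h1 := ksign_smul hk ι₀ e σ t
  rw [hσt t hts hts'] at h1
  have hχ : (if σ • ι₀ = ι₀ then (1 : ℚ) else -1) = 1 := by
    by_cases ht : t.comp e = ι₀
    · rw [if_pos ht] at h1; linarith
    · rw [if_neg ht] at h1; linarith
  have h2 := ksign_smul hk ι₀ e σ s
  have h3 := ksign_smul hk ι₀ e (starRingAut : ℂ ≃+* ℂ) s
  rw [hσs, h3, if_neg hρ, hχ] at h2
  by_cases hs : s.comp e = ι₀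
  · rw [if_pos hs] at h2; norm_num at h2
  · rw [if_neg hs] at h2; norm_num at h2

/-- **The Galois closure of a sextic CM field with an imaginary quadratic subfield has degree `6` or `12`**: it divides
`48` (Dodson) and is a multiple of `6`, and degree `24` or `48` would give pair flips. [cite: Dodson1984, §5.1.2 Theorem] -/
theorem finrank_normalClosure_of_quadratic {i : I} (h6 : finrank ℚ (K i) = 6) (hk : finrank ℚ k = 2) (e : k →+* K i) :
    finrank ℚ ↥(normalClosure ℚ (K i) ℂ) = 6 ∨ finrank ℚ ↥(normalClosure ℚ (K i) ℂ) = 12 := by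
  haveI : NumberField ↥(normalClosure ℚ (K i) ℂ) := NumberField.mk
  haveI : IsNormalClosure ℚ (K i) ↥(normalClosure ℚ (K i) ℂ) :=
    Algebra.IsAlgebraic.isNormalClosure_normalClosure fun x => IsAlgClosed.splits _
  haveI : IsCMField ↥(normalClosure ℚ (K i) ℂ) := isCMField_of_isNormalClosure (K := K i) (L := ↥(normalClosure ℚ (K i) ℂ))
  have h48 : finrank ℚ ↥(normalClosure ℚ (K i) ℂ) ∣ 48 :=
    finrank_dvd_48_of_sextic_cm (L := ↥(normalClosure ℚ (K i) ℂ)) (K i) h6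
  have h6dvd : 6 ∣ finrank ℚ ↥(normalClosure ℚ (K i) ℂ) := h6 ▸ finrank_dvd_finrank_normalClosure (K := K) i
  have hnot : ¬ (finrank ℚ ↥(normalClosure ℚ (K i) ℂ) = 24 ∨ finrank ℚ ↥(normalClosure ℚ (K i) ℂ) = 48) := fun h =>
    not_forall_pairFlip_of_quadratic h6 hk e (GenericCMField.pairFlip_of_finrank_normalClosure h6 _ h)
  have hpos : 0 < finrank ℚ ↥(normalClosure ℚ (K i) ℂ) := Module.finrank_pos
  have hle : finrank ℚ ↥(normalClosure ℚ (K i) ℂ) ≤ 48 := Nat.le_of_dvd (by norm_num) h48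
  obtain ⟨m, hm⟩ := h6dvd
  interval_cases h : finrank ℚ ↥(normalClosure ℚ (K i) ℂ) <;> omega

/-- In particular `8 ∤ [L:ℚ]` for the Galois closure `L` of a sextic CM field with an imaginary quadratic subfield.
[cite: Dodson1984, §5.1.2 Theorem] -/
theorem not_eight_dvd_finrank_normalClosure_of_quadratic {i : I} (h6 : finrank ℚ (K i) = 6) (hk : finrank ℚ k = 2)
    (e : k →+* K i) : ¬ 8 ∣ finrank ℚ ↥(normalClosure ℚ (K i) ℂ) := by
  rcases finrank_normalClosure_of_quadratic h6 hk e with h | h <;> rw [h] <;> decide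

end Quadratic

/-! ## §2 At most two non-pair-flip threefolds in one closure -/

section Count

/-- **Three sextic CM fields with one Galois closure, each with a totally complex quadratic subfield not embedding in the
others: impossible** (the images of the three quadratic fields are three imaginary quadratic subfields of a field of degree
`6` or `12`). [cite: Dodson1984, §5.1.2 Theorem] [cite: Shimura1998, §8.4] -/
theorem false_of_three_quadratic_of_normalClosure_eq {a b c : I} (hab : a ≠ b) (hac : a ≠ c) (hbc : b ≠ c)
    (h6 : ∀ i, finrank ℚ (K i) = 6) (F : ∀ i, IntermediateField ℚ (K i)) (hF2 : ∀ i, finrank ℚ (F i) = 2)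
    (hFtc : ∀ i, IsTotallyComplex (F i))
    (hL : ∀ i j, normalClosure ℚ (K i) ℂ = normalClosure ℚ (K j) ℂ)
    (hno : ∀ i j, i ≠ j → IsEmpty (F i →+* K j)) : False := by
  classical
  -- embeddings and the images `Q_i` of the quadratic fields
  have x : ∀ i, K i →+* ℂ := fun i => Classical.arbitrary _
  let q : ∀ i, ↥(F i) →+* ℂ := fun i => (x i).comp (algebraMap (↥(F i)) (K i))
  let Q : I → IntermediateField ℚ ℂ := fun i => (q i).toRatAlgHom.fieldRange
  have hQ2 : ∀ i, finrank ℚ ↥(Q i) = 2 := fun i =>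
    ((AlgEquiv.ofInjectiveField (q i).toRatAlgHom).toLinearEquiv.finrank_eq).symm.trans (hF2 i)
  have hQi : ∀ i, ∃ z ∈ Q i, starRingEnd ℂ z ≠ z := fun i => by
    haveI := hFtc i
    by_contra hno'
    push Not at hno'
    have hreal : ComplexEmbedding.IsReal (q i) := ComplexEmbedding.isReal_iff.2 (RingHom.ext fun w =>
      by rw [ComplexEmbedding.conjugate_coe_eq]; exact hno' _ (AlgHom.mem_fieldRange.2 ⟨w, rfl⟩))
    exact IsTotallyComplex.complexEmbedding_not_isReal (q i) hreal
  have hQL : ∀ i, Q i ≤ normalClosure ℚ (K a) ℂ := fun i => by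
    rw [hL a i]
    intro z hz
    obtain ⟨w, rfl⟩ := AlgHom.mem_fieldRange.1 hz
    exact apply_mem_normalClosure i (x i) _
  have h8 := not_eight_dvd_finrank_normalClosure_of_quadratic (K := K) (h6 a) (hF2 a) (algebraMap (↥(F a)) (K a))
  -- two of the three images coincide: an embedding `F_i → K_j`
  have hemb : ∀ i j, Q i = Q j → Nonempty (↥(F i) →+* K j) := fun i j h =>
    ⟨(algebraMap (↥(F j)) (K j)).comp
      (((AlgEquiv.ofInjectiveField (q i).toRatAlgHom).trans
        ((IntermediateField.equivOfEq h).trans (AlgEquiv.ofInjectiveField (q j).toRatAlgHom).symm)).toRingEquiv.toRingHom)⟩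
  rcases quadratic_eq_or_eq_or_eq_of_not_eight_dvd (L := normalClosure ℚ (K a) ℂ) h8 (hQ2 a) (hQ2 b) (hQ2 c)
    (hQi a) (hQi b) (hQi c) (hQL a) (hQL b) (hQL c) with h | h | h
  · exact (hno a b hab).false (Classical.choice (hemb a b h))
  · exact (hno a c hac).false (Classical.choice (hemb a c h))
  · exact (hno b c hbc).false (Classical.choice (hemb b c h))

end Count

/-! ## §3 The sextic block: simple CM threefolds with one Galois closure -/

section SexticBlock

variable [Fintype I] [DecidableEq I] [Nonempty I] {Φ : ∀ i, CMType (K i)}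
variable {A : I → AbelianVariety ℂ} {ι : ∀ i, 𝓞 (K i) →+* End (A i)}
  {θ : ∀ i, K i →+* Module.End ℂ (complexBetti (A i).X 1)}

open scoped Classical in
/-- **The sextic block.**  Simple, pairwise non-isogenous CM abelian threefolds whose sextic CM fields have ONE Galois
closure in `ℂ`, pairwise share no imaginary quadratic subfield, and fall at most three at a time into an isomorphism class of
fields: the family of their CM types is nondegenerate (`Hg(∏ T_i) = ∏ Hg(T_i)`).
[cite: MoonenZarhin1999LowDim, §3 (3.1)] [cite: Dodson1984, §5.1.2 Theorem] [cite: Gordon1999HodgeAVSurvey, 7.5] -/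
theorem isNondegenerateFamily_sextic_block (hA : ∀ i, IsCMTypeRealisation (Φ i) (A i) (ι i) (θ i))
    (hS : ∀ i, (A i).IsSimple) (hniso : ∀ i j, i ≠ j → ¬ AbelianVariety.IsIsogenous (A i) (A j))
    (h6 : ∀ i, finrank ℚ (K i) = 6) (hL : ∀ i j, normalClosure ℚ (K i) ℂ = normalClosure ℚ (K j) ℂ)
    (hno : ∀ i j, i ≠ j →
      ¬ ∃ F : IntermediateField ℚ (K i), finrank ℚ F = 2 ∧ IsTotallyComplex F ∧ Nonempty (F →+* K j))
    (htri : ∀ i, (Finset.univ.filter fun j => Nonempty (K j ≃+* K i)).card ≤ 3) :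
    CMAlgebra.IsNondegenerateFamily Φ := by
  classical
  have hnd : ∀ i, IsNondegenerate (Φ i) := fun i =>
    isNondegenerate_of_isSimple_of_dim_le_three_slot hA (hS i) (by
      have := finrank_eq_two_mul_dim_of_isCMTypeRealisation (hA i); rw [h6 i] at this; omega)
  -- the pair-flip predicate and the dichotomy
  let P : I → Prop := fun i => ∀ s : K i →+* ℂ, ∃ σ : ℂ ≃+* ℂ, σ • s = (starRingAut : ℂ ≃+* ℂ) • s ∧
    ∀ t : K i →+* ℂ, t ≠ s → t ≠ (starRingAut : ℂ ≃+* ℂ) • s → σ • t = t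
  have hdich : ∀ i, ¬ P i → ∃ F : IntermediateField ℚ (K i), finrank ℚ F = 2 ∧ IsTotallyComplex F := fun i hi =>
    (pairFlip_or_exists_imaginary_quadratic (h6 i)).resolve_left hi
  refine isNondegenerateFamily_of_fibers Φ (fun i => decide (P i)) (fun i j hij => ?_) (fun c hc => ?_)
  · -- across the two parts: a pair-flip field against a field with an imaginary quadratic subfield
    by_cases hi : P i
    · have hj : ¬ P j := fun hj => hij (by rw [decide_eq_true hi, decide_eq_true hj])
      obtain ⟨F, hF2, hFtc⟩ := hdich j hj
      haveI := hFtc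
      exact (pairwise_pairFlip_quadraticSextic (Φ := Φ) (k := ↥F) hi (h6 i) (h6 j) hF2 (algebraMap (↥F) (K j)) (hnd j)).1
    · have hj : P j := by
        by_contra hj; exact hij (by rw [decide_eq_false hi, decide_eq_false hj])
      obtain ⟨F, hF2, hFtc⟩ := hdich i hi
      haveI := hFtc
      exact (pairwise_pairFlip_quadraticSextic (Φ := Φ) (k := ↥F) hj (h6 j) (h6 i) hF2 (algebraMap (↥F) (K i)) (hnd i)).2
  · obtain ⟨i₀, hi₀⟩ := hc
    haveI : Nonempty {i // decide (P i) = c} := ⟨⟨i₀, hi₀⟩⟩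
    cases c with
    | true =>
      -- the pair-flip part: fibres along the isomorphism class of the field
      have hP : ∀ i : {i // decide (P i) = true}, P i.1 := fun i => of_decide_eq_true i.2
      refine isNondegenerateFamily_of_fibers (K := fun i : {i // decide (P i) = true} => K i.1) (fun i => Φ i.1)
        (fun i => Finset.univ.filter fun j : I => Nonempty (K j ≃+* K i.1)) (fun i j hij => ?_) (fun c' hc' => ?_)
      · -- different isomorphism classes: the twin theorem
        have hne : IsEmpty (K i.1 ≃+* K j.1) := ⟨fun e => hij (by
          ext j'
          simp only [Finset.mem_filter, Finset.mem_univ, true_and]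
          exact ⟨fun ⟨f⟩ => ⟨f.trans e⟩, fun ⟨f⟩ => ⟨f.trans e.symm⟩⟩)⟩
        exact (pairwise_pairFlip_of_normalClosure_le_of_isEmpty (Φ := fun i : {i // decide (P i) = true} => Φ i.1)
          (h6 i.1) (h6 j.1) (hP i) (hP j) (hL j.1 i.1).le hne).1
      · -- one isomorphism class: at most three members, seat p2's theorem transported
        obtain ⟨j₀, hj₀⟩ := hc'
        have hiso : ∀ j : {j : {i // decide (P i) = true} // (Finset.univ.filter fun j' : I => Nonempty (K j' ≃+* K j.1)) = c'},
            Nonempty (K j.1.1 ≃+* K j₀.1) := fun j => by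
          have h1 : j.1.1 ∈ c' :=
            (Finset.ext_iff.1 j.2 j.1.1).1 (Finset.mem_filter.2 ⟨Finset.mem_univ _, ⟨RingEquiv.refl _⟩⟩)
          have h2 : j.1.1 ∈ (Finset.univ.filter fun j' : I => Nonempty (K j' ≃+* K j₀.1)) :=
            (Finset.ext_iff.1 hj₀ j.1.1).2 h1
          exact (Finset.mem_filter.1 h2).2
        let e : ∀ j : {j : {i // decide (P i) = true} // (Finset.univ.filter fun j' : I => Nonempty (K j' ≃+* K j.1)) = c'},
            K j.1.1 ≃+* K j₀.1 := fun j => Classical.choice (hiso j)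
        haveI : Nonempty {j : {i // decide (P i) = true} //
            (Finset.univ.filter fun j' : I => Nonempty (K j' ≃+* K j.1)) = c'} := ⟨⟨j₀, hj₀⟩⟩
        refine isNondegenerateFamily_of_ringEquiv_of_pairFlip_of_card_le_three
          (K := fun j : {j : {i // decide (P i) = true} //
            (Finset.univ.filter fun j' : I => Nonempty (K j' ≃+* K j.1)) = c'} => K j.1.1)
          e (hP j₀) (fun j => hA j.1.1) (fun a b hab => hniso a.1.1 b.1.1 fun h => hab (Subtype.ext (Subtype.ext h)))
          ?_
        -- cardinality: the fibre injects into the class of `K_{j₀}`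
        calc Fintype.card {j : {i // decide (P i) = true} //
              (Finset.univ.filter fun j' : I => Nonempty (K j' ≃+* K j.1)) = c'}
            ≤ (Finset.univ.filter fun j' : I => Nonempty (K j' ≃+* K j₀.1)).card := by
              rw [← Fintype.card_coe]
              refine Fintype.card_le_of_injective (fun j => ⟨j.1.1, Finset.mem_filter.2 ⟨Finset.mem_univ _, hiso j⟩⟩)
                fun a b hab => Subtype.ext (Subtype.ext (congrArg (fun x : ↥(Finset.univ.filter fun j' : I =>
                  Nonempty (K j' ≃+* K j₀.1)) => (x : I)) hab))
          _ ≤ 3 := htri j₀.1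
    | false =>
      -- the non-pair-flip part: at most two members
      have hP : ∀ i : {i // decide (P i) = false}, ¬ P i.1 := fun i => of_decide_eq_false i.2
      have hF := fun i : {i // decide (P i) = false} => hdich i.1 (hP i)
      choose F hF2 hFtc using hF
      have hcard : Fintype.card {i // decide (P i) = false} ≤ 2 := by
        by_contra hlt
        obtain ⟨a, b, c, hab, hac, hbc⟩ :=
          (Fintype.two_lt_card_iff (α := {i // decide (P i) = false})).1 (by omega)
        refine false_of_three_quadratic_of_normalClosure_eq (K := fun i : {i // decide (P i) = false} => K i.1)
          hab hac hbc (fun i => h6 i.1) F hF2 hFtc (fun i j => hL i.1 j.1) fun i j hij => ⟨fun g => ?_⟩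
        exact hno i.1 j.1 (fun h => hij (Subtype.ext h)) ⟨F i, hF2 i, hFtc i, ⟨g⟩⟩
      rcases subsingleton_or_exists_pair_of_card_le_two hcard with hsub | ⟨i₁, i₂, h12, hI⟩
      · haveI := hsub
        exact isNondegenerateFamily_of_subsingleton _ fun i => hnd i.1
      · haveI := hFtc i₁
        haveI := hFtc i₂
        refine isNondegenerateFamily_sexticThreefolds_of_isEmpty_quadratic_ringHom
          (K := fun i : {i // decide (P i) = false} => K i.1) (k₀ := ↥(F i₁)) (k₁ := ↥(F i₂)) h12 hI (hF2 i₁) (hF2 i₂)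
          (fun i => h6 i.1) (algebraMap (↥(F i₁)) (K i₁.1)) (algebraMap (↥(F i₂)) (K i₂.1)) ⟨fun g => ?_⟩
          (fun i => hA i.1) (fun i => hS i.1)
        exact hno i₁.1 i₂.1 (fun h => h12 (Subtype.ext h))
          ⟨F i₁, hF2 i₁, hFtc i₁, ⟨(algebraMap (↥(F i₂)) (K i₂.1)).comp g⟩⟩

end SexticBlock

/-! ## §4 The quartic block: at most two simple CM surfaces -/

section QuarticBlock

variable [Fintype I] [DecidableEq I] [Nonempty I] {Φ : ∀ i, CMType (K i)}
variable {A : I → AbelianVariety ℂ} {ι : ∀ i, 𝓞 (K i) →+* End (A i)}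
  {θ : ∀ i, K i →+* Module.End ℂ (complexBetti (A i).X 1)}

omit [DecidableEq I] in
/-- **The quartic block.**  At most two simple, pairwise non-isogenous CM abelian surfaces: the family is nondegenerate
(Moonen–Zarhin, seat b23's `isNondegenerateFamily_simpleSurfaces`; one surface: Ribet). [cite: MoonenZarhin1999LowDim, Thm. (0.2)] -/
theorem isNondegenerateFamily_quartic_block (hA : ∀ i, IsCMTypeRealisation (Φ i) (A i) (ι i) (θ i))
    (hS : ∀ i, (A i).IsSimple) (hniso : ∀ i j, i ≠ j → ¬ AbelianVariety.IsIsogenous (A i) (A j))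
    (h4 : ∀ i, finrank ℚ (K i) = 4) (hcard : Fintype.card I ≤ 2) : CMAlgebra.IsNondegenerateFamily Φ := by
  rcases subsingleton_or_exists_pair_of_card_le_two hcard with hsub | ⟨i₁, i₂, h12, hI⟩
  · haveI := hsub
    exact isNondegenerateFamily_of_subsingleton _ fun i => isNondegenerate_of_isSimple_of_dim_le_three_slot hA (hS i) (by
      have := finrank_eq_two_mul_dim_of_isCMTypeRealisation (hA i); rw [h4 i] at this; omega)
  · exact isNondegenerateFamily_simpleSurfaces h12 hI h4 hA hS hniso

end QuarticBlock

end Summit.HodgeConjecture.CorCM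

end
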